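import Literature.AnabelianGeometry.EtaleTheta.Discharge.Sec5PsiPreservesFrobeniusTrivial
import Literature.AnabelianGeometry.EtaleTheta.FrobenioidThetaDivisorPrincipalTransport
import Literature.AnabelianGeometry.EtaleTheta.FrobenioidThetaDivisorPrincipalOfModel
import HarnessLib

/-!
# [EtTh] §5, Prop. 5.3: the F1 binders at the ASSEMBLED §5 data `ofBiKummerData` / `ofConnectedTemperoidData` — F1 = `Div_B(B)`
# on the nose, F1-Aut OUTRIGHT, F1-Ψ modulo {`induced`, the model hypotheses} (PROOF-ONLY; 0 definitions)

S. Mochizuki, *The étale theta function and its Frobenioid-theoretic manifestations*, Publ. RIMS **45** (2009)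
[MochizukiEtTh2009]: §4 p. 312 (PDF p. 86); Prop. 5.3 p. 325–326 (PDF pp. 99–100), proof p. 326 («the image of the birational
function monoid»); proof of Thm. 5.6 p. 329 (PDF p. 103) l. 9 («[cf. [FrdI], Theorem 3.4]»); S. Mochizuki, *The geometry of
Frobenioids I* [MochizukiFrdI2008]: Rem. 1.1.1 p. 21, Thm. 3.4 (ii)(iii)(v) pp. 62–63, Thm. 4.9 p. 88, Thm. 5.2 (ii) p. 101.
[cite: MochizukiEtTh2009, Prop 5.3 proof p.326 (PDF p.100)] [cite: MochizukiFrdI2008, Thm. 3.4 (v) p.63]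
[cite: MochizukiFrdI2008, Thm. 5.2 (ii) p.101]

Cell abc-iut, layer L2 ([EtTh] §5), seat abc-iut-L6-d1 (gen 5), row «F1-BIRAT» sequel «F1-AT-MODEL-DATA» (STATUS 17:00Z).
Everything BY NAME: this lineage's printed F1 `FrobenioidThetaDivisors.principalDivisors` with `gpMap_psiPhi_mem_principalDivisors_iff`
/ `gpMap_pullAut_mem_principalDivisors_iff` (p456447) and `mem_principalDivisors_ofModel_iff` (p456582); abc-iut-L1's [FrdI]
Thm. 3.4 (iii) `FrdI.thm34iii_morphisms_of_isOfFSMType` (clauses «linear», «base-isomorphism»), Thm. 3.4 (v)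
`PreFrobenioid.baseEquivalent_map_of_isSlim`, Rem. 1.1.1 `PreFrobenioid.isIsometry_of_isIso`, Thm. 5.2
`ModelFrobenioid.isFrobenioid` / `data_isOfQuasiIsotropicType` / `data_isNonDilatingOn_iff`; abc-iut-L2-t9's
`TemperedFrobenioid.isUnit_ratFnFunctor`; abc-iut-L2-t4's assembled data `ThetaFrobenioid.ofBiKummerData` /
`ofConnectedTemperoidData` (whose `pre` IS the model's operations, `rfl`); the base theorems
`QuasiTemperoid.BTempConnected.connectedPart_isOfFSMType` ([FrdII] Ex. 1.3) and `TemperedArithmeticGroup.isSlim_connectedPart`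
([SemiAnbd] Rmk. 3.4.1) — the pattern of abc-iut-w5-d013's `hΨFT_ofBiKummerData` / `hbs_ofConnectedTemperoidData` (p446049).

WHAT IS PROVED.
§1 (the setting's tempered Frobenioid `S.C = ModelFrobenioid Φ B Div_B`, operations `PreFrobenioidData.ofModel …`):
  * `div_iso_eq_one_of_hypotheses` — isomorphisms are isometries (`hiso`), from [FrdI] Thm. 5.2's «Frobenioid»;
  * `preSteps_baseEquivalent_map_of_model` — for EVERY self-equivalence `Ψ`, `Ψ` AND `Ψ⁻¹` preserve pre-steps and base-equivalent
    pairs ([FrdI] Thm. 3.4 (ii)/(iii)/(v)) over a slim base of FSM-type, `Φ` non-dilating, a non-group-like object — the four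
    binders `hpre`/`hbe`/`hpre′`/`hbe′` of `gpMap_psiPhi_mem_principalDivisors_iff` as THEOREMS;
  * `mem_principalDivisors_iff_of_model` — `x ∈ Φ(A^bs)^gp` is principal iff `x = Div_B(b)`, `b ∈ B(A^bs)`, HYPOTHESIS-FREE
    (`B` is group-like at a tempered Frobenioid: [EtTh] Def. 3.6 (i), `isUnit_BΛ`).
§2 (at `𝔉 := ofBiKummerData …`): `mem_principalDivisors_ofBiKummerData_iff` (F1 = `Div_B(B(A^bs))`, hypothesis-free);
  `gpMap_pullAut_mem_principalDivisors_iff_ofBiKummerData` (F1-Aut, modulo the model hypotheses `h` only);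
  `gpMap_psiPhi_mem_principalDivisors_iff_ofBiKummerData` (F1-Ψ modulo {`induced` ([FrdI] Thm. 4.9 at `A_⊚`), `hD`, `hslim`,
  `hnd`, `hN`}).
§3 (at `𝔉 := ofConnectedTemperoidData …` over `B^temp(Π^tp_X)⁰`): the same with `hD`, `hslim` DISCHARGED by the tree —
  `gpMap_psiPhi_mem_principalDivisors_iff_ofConnectedTemperoidData` modulo {`induced`, `hnd`, `hN`} and
  `gpMap_pullAut_mem_principalDivisors_iff_ofConnectedTemperoidData` modulo `h`.
NET EFFECT on the binder list of the perfect-`Φ` capstone for a `Q`-datum at the genuine data whose F1 field is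
`principalDivisors 𝔉.pre A_⊚` (`FrobenioidThetaDivisorSupportQPrincipal.lean`): F1-Aut GONE; F1-Ψ ↦ {`induced`, `hnd`, `hN`}.
HONEST FRAMING: kernel-checked statements about OUR typed §5 data; no `Q`-datum at the genuine data is constructed here; nothing
here asserts a result of [EtTh] for an actual curve; typed ≠ proved; no side is taken on [IUTchIII] Cor. 3.12.
-/

-- `(PreFrobenioidData.ofFunctor Φ F).base` is `baseFunctor F` only at default transparency (as in abc-iut-L1's files).
set_option backward.isDefEq.respectTransparency false

namespace Literature.AnabelianGeometry.EtaleTheta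

open CategoryTheory Opposite Literature.AlgebraicGeometry.Frobenioids Literature.AnabelianGeometry.SemiGraphs
  FrobenioidThetaDivisors

namespace BiKummerSetting

universe u₀ v₀ u v w

/-! ### §1 The model hypotheses ⇒ `hiso`, `hpre`/`hbe`/`hpre′`/`hbe′`; F1 = `Div_B(B)` -/

section General

variable {K : Type u₀} [Field K]
  {X : SemiGraphs.TemperedArithmeticGroup.{u₀} K} {D₀ : Type u₀} [Category.{v₀} D₀]
  {V : FrdIMonoidStub.{w}} {T₀ : RealifiedDivisorMonoids (D₀ := D₀) V} {D : Type u} [Category.{v} D]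
  {VD : FrdICatStub.{u, v, w} D} (S : BiKummerSetting X T₀ D VD)
  (h : ModelFrobenioid.Hypotheses S.tf.divisorMonoid S.tf.ratFnFunctor)

include h in
/-- **Isomorphisms of the setting's tempered Frobenioid are isometries** (`Div(c) = 0`; [FrdI] Rem. 1.1.1 / Def. 1.2 in a
pre-Frobenioid, `PreFrobenioid.isIsometry_of_isIso`; the model Frobenioid is a Frobenioid by [FrdI] Thm. 5.2) — the binder `hiso`.
[cite: MochizukiFrdI2008, Rem. 1.1.1 p.21] [cite: MochizukiFrdI2008, Thm. 5.2 (ii) p.101] -/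
theorem div_iso_eq_one_of_hypotheses ⦃A B : S.C⦄ (c : A ≅ B) :
    (PreFrobenioidData.ofModel S.tf.divisorMonoid S.tf.ratFnFunctor S.tf.divBNatTrans).div c.hom = 1 :=
  PreFrobenioid.isIsometry_of_isIso S.F
    (ModelFrobenioid.isFrobenioid (DivB := S.tf.divBNatTrans) h.isMonoidOn h.isDivisorial h.isMonoidOn_rat
      h.isGroupLike_rat h.isGraphConnected h.isTotallyEpimorphic).isPreFrobenioid c.hom

include h in
/-- **[FrdI] Thm. 3.4 (ii)/(iii)/(v) for the setting's tempered Frobenioid**: every self-equivalence `Ψ`, and its inverse,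
preserve PRE-STEPS (clauses «linear», «base-isomorphism» of Thm. 3.4 (iii)) and BASE-EQUIVALENT PAIRS (Thm. 3.4 (v), slim base)
— over a base of FSM-type, with `Φ` non-dilating and a non-group-like object (the model hypotheses of abc-iut-w5-d013's
`hΨFT_ofBiKummerData`).  [cite: MochizukiFrdI2008, Thm. 3.4 (v) p.63] [cite: MochizukiEtTh2009, Thm 5.6 proof p.329 (PDF p.103)] -/
theorem preSteps_baseEquivalent_map_of_model (hD : IsOfFSMType D) (hslim : IsSlim D)
    (hnd : IsNonDilatingOn S.tf.divisorMonoid)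
    (hN : ∃ A : S.C, ¬ (PreFrobenioidData.ofModel S.tf.divisorMonoid S.tf.ratFnFunctor S.tf.divBNatTrans).IsGroupLikeObj A)
    (Ψ : S.C ≌ S.C) :
    (∀ ⦃A B : S.C⦄ (φ : A ⟶ B),
      (PreFrobenioidData.ofModel S.tf.divisorMonoid S.tf.ratFnFunctor S.tf.divBNatTrans).IsPreStep φ →
        (PreFrobenioidData.ofModel S.tf.divisorMonoid S.tf.ratFnFunctor S.tf.divBNatTrans).IsPreStep (Ψ.functor.map φ)) ∧
    (∀ ⦃A B : S.C⦄ (φ ψ : A ⟶ B),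
      (PreFrobenioidData.ofModel S.tf.divisorMonoid S.tf.ratFnFunctor S.tf.divBNatTrans).BaseEquivalent φ ψ →
        (PreFrobenioidData.ofModel S.tf.divisorMonoid S.tf.ratFnFunctor S.tf.divBNatTrans).BaseEquivalent
          (Ψ.functor.map φ) (Ψ.functor.map ψ)) ∧
    (∀ ⦃A B : S.C⦄ (φ : A ⟶ B),
      (PreFrobenioidData.ofModel S.tf.divisorMonoid S.tf.ratFnFunctor S.tf.divBNatTrans).IsPreStep φ →
        (PreFrobenioidData.ofModel S.tf.divisorMonoid S.tf.ratFnFunctor S.tf.divBNatTrans).IsPreStep (Ψ.inverse.map φ)) ∧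
    (∀ ⦃A B : S.C⦄ (φ ψ : A ⟶ B),
      (PreFrobenioidData.ofModel S.tf.divisorMonoid S.tf.ratFnFunctor S.tf.divBNatTrans).BaseEquivalent φ ψ →
        (PreFrobenioidData.ofModel S.tf.divisorMonoid S.tf.ratFnFunctor S.tf.divBNatTrans).BaseEquivalent
          (Ψ.inverse.map φ) (Ψ.inverse.map ψ)) := by
  have hF : PreFrobenioid.IsFrobenioid S.F :=
    ModelFrobenioid.isFrobenioid (DivB := S.tf.divBNatTrans) h.isMonoidOn h.isDivisorial h.isMonoidOn_rat
      h.isGroupLike_rat h.isGraphConnected h.isTotallyEpimorphic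
  have hq := ModelFrobenioid.data_isOfQuasiIsotropicType (DivB := S.tf.divBNatTrans) h
  have hnd' : (ModelFrobenioid.data S.tf.divisorMonoid S.tf.ratFnFunctor S.tf.divBNatTrans).IsNonDilatingOn :=
    (ModelFrobenioid.data_isNonDilatingOn_iff S.tf.divisorMonoid S.tf.ratFnFunctor S.tf.divBNatTrans).mpr hnd
  -- [FrdI] Thm. 3.4 (iii) for `Ψ` and for `Ψ⁻¹`
  obtain ⟨hlist, -⟩ := FrdI.thm34iii_morphisms_of_isOfFSMType hF hF hq hq hD hD hnd' hnd' Ψ hN hN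
  obtain ⟨hlist', -⟩ := FrdI.thm34iii_morphisms_of_isOfFSMType hF hF hq hq hD hD hnd' hnd' Ψ.symm hN hN
  refine ⟨fun A B φ hφ => ⟨hlist.2.1 φ hφ.1, hlist.2.2.1 φ hφ.2⟩, fun A B φ ψ hφψ => ?_,
    fun A B φ hφ => ⟨hlist'.2.1 φ hφ.1, hlist'.2.2.1 φ hφ.2⟩, fun A B φ ψ hφψ => ?_⟩
  · -- [FrdI] Thm. 3.4 (v), first sentence (slim base): `Ψ` preserves base-equivalent pairs
    exact PreFrobenioid.baseEquivalent_map_of_isSlim hF hF Ψ hslim (fun X Y f hf => hlist.2.2.1 f hf) hφψ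
  · exact PreFrobenioid.baseEquivalent_map_of_isSlim hF hF Ψ.symm hslim (fun X Y f hf => hlist'.2.2.1 f hf) hφψ

/-- **F1 = `Div_B(B(A^bs))` on the nose, hypothesis-free, for the setting's tempered Frobenioid**: `x ∈ Φ(A^bs)^gp` is principal
(`principalDivisors`) iff `x = Div_B(b)` for some `b ∈ B(A^bs)` — `B` is group-like at a tempered Frobenioid ([EtTh] Def. 3.6 (i);
abc-iut-L2-t9's `TemperedFrobenioid.isUnit_ratFnFunctor`), so this lineage's `mem_principalDivisors_ofModel_iff` applies
([FrdI] Thm. 5.2 (ii)).  [cite: MochizukiFrdI2008, Thm. 5.2 (ii) p.101] [cite: MochizukiEtTh2009, Prop 5.3 proof p.326 (PDF p.100)] -/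
theorem mem_principalDivisors_iff_of_model (A : S.C)
    (x : Algebra.GrothendieckGroup (S.tf.divisorMonoid.obj (op A.base))) :
    x ∈ principalDivisors (PreFrobenioidData.ofModel S.tf.divisorMonoid S.tf.ratFnFunctor S.tf.divBNatTrans) A ↔
      ∃ b : S.tf.ratFnFunctor.obj (op A.base), divB S.tf.divisorMonoid S.tf.ratFnFunctor S.tf.divBNatTrans (op A.base) b = x :=
  mem_principalDivisors_ofModel_iff A (S.tf.isUnit_ratFnFunctor T₀.isUnit_BΛ A) x

end General

end BiKummerSetting

namespace ThetaFrobenioid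

universe u₀ v₀ u v w

/-! ### §2a The MODEL CASE: any §5 datum whose operations are the setting's model (`h𝔉 : 𝔉.pre = ofModel …`) -/

section ModelCase

variable {K : Type u₀} [Field K]
  {X : SemiGraphs.TemperedArithmeticGroup.{u₀} K} {D₀ : Type u₀} [Category.{v₀} D₀]
  {V : FrdIMonoidStub.{w}} {T₀ : RealifiedDivisorMonoids (D₀ := D₀) V} {D : Type u} [Category.{v} D]
  {VD : FrdICatStub.{u, v, w} D} {S : BiKummerSetting X T₀ D VD}
  (h : ModelFrobenioid.Hypotheses S.tf.divisorMonoid S.tf.ratFnFunctor)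
  (𝔉 : ThetaFrobenioid.{w} S.C D)
  (h𝔉 : 𝔉.pre = PreFrobenioidData.ofModel S.tf.divisorMonoid S.tf.ratFnFunctor S.tf.divBNatTrans)

include h h𝔉 in
/-- **F1-Aut in the model case** (`h𝔉 : 𝔉.pre = ofModel …`, e.g. `ofBiKummerData_pre`, `rfl`): `g·x` is principal iff `x` is,
the input «isomorphisms are isometries» DISCHARGED by the model hypotheses.
[cite: MochizukiEtTh2009, Prop 5.3 (vi) p.326 (PDF p.100)] [cite: MochizukiFrdI2008, Rem. 1.1.1 p.21] -/
theorem gpMap_pullAut_mem_principalDivisors_iff_of_pre_eq {A : S.C} (g : Aut A)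
    (x : Algebra.GrothendieckGroup (𝔉.pre.Mon (𝔉.base.obj A))) :
    ThetaFrobenioid.gpMap (𝔉.pullAut g).toMonoidHom x ∈ principalDivisors 𝔉.pre A ↔ x ∈ principalDivisors 𝔉.pre A := by
  have hiso : ∀ ⦃A B : S.C⦄ (c : A ≅ B), 𝔉.pre.div c.hom = 1 := by
    rw [h𝔉]; exact S.div_iso_eq_one_of_hypotheses h
  exact gpMap_pullAut_mem_principalDivisors_iff 𝔉 hiso g x

include h h𝔉 in
/-- **F1-Ψ in the model case** (`h𝔉 : 𝔉.pre = ofModel …`): for every self-equivalence `Ψ`, chosen `ι : Ψ(A_⊚) ⥲ A_⊚` and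
`Ψ`-INDUCED `e` ([FrdI] Thm. 4.9's divisor clause, `induced`), `(Ψ^Φ_{A_⊚})^gp x` is principal iff `x` is — the four
[FrdI] Thm. 3.4 (ii)(v) binders and `hiso` of `gpMap_psiPhi_mem_principalDivisors_iff` DISCHARGED over a slim base of FSM-type
(`Φ` non-dilating, a non-group-like object).
[cite: MochizukiEtTh2009, Prop 5.3 proof p.326 (PDF p.100)] [cite: MochizukiFrdI2008, Thm. 3.4 (v) p.63] [cite: MochizukiFrdI2008, Thm. 4.9 p.88] -/
theorem gpMap_psiPhi_mem_principalDivisors_iff_of_pre_eq (hD : IsOfFSMType D) (hslim : IsSlim D)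
    (hnd : IsNonDilatingOn S.tf.divisorMonoid)
    (hN : ∃ A : S.C, ¬ (PreFrobenioidData.ofModel S.tf.divisorMonoid S.tf.ratFnFunctor S.tf.divBNatTrans).IsGroupLikeObj A)
    (Ψ : S.C ≌ S.C) (ι : Ψ.functor.obj 𝔉.Acirc ≅ 𝔉.Acirc)
    {e : 𝔉.PhiAcirc ≃* 𝔉.pre.Mon (𝔉.base.obj (Ψ.functor.obj 𝔉.Acirc))}
    (induced : (DivisorTransportStub.ofThm49 𝔉).IsInducedBy Ψ 𝔉.Acirc e)
    (x : Algebra.GrothendieckGroup 𝔉.PhiAcirc) :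
    ThetaFrobenioid.gpMap (psiPhi 𝔉 Ψ ι e).toMonoidHom x ∈ principalDivisors 𝔉.pre 𝔉.Acirc ↔
      x ∈ principalDivisors 𝔉.pre 𝔉.Acirc := by
  obtain ⟨hpre, hbe, hpre', hbe'⟩ := S.preSteps_baseEquivalent_map_of_model h hD hslim hnd hN Ψ
  have hpre₁ : ∀ ⦃A B : S.C⦄ (φ : A ⟶ B), 𝔉.pre.IsPreStep φ → 𝔉.pre.IsPreStep (Ψ.functor.map φ) := by
    rw [h𝔉]; exact hpre
  have hbe₁ : ∀ ⦃A B : S.C⦄ (φ ψ : A ⟶ B), 𝔉.pre.BaseEquivalent φ ψ →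
      𝔉.pre.BaseEquivalent (Ψ.functor.map φ) (Ψ.functor.map ψ) := by
    rw [h𝔉]; exact hbe
  have hpre₁' : ∀ ⦃A B : S.C⦄ (φ : A ⟶ B), 𝔉.pre.IsPreStep φ → 𝔉.pre.IsPreStep (Ψ.inverse.map φ) := by
    rw [h𝔉]; exact hpre'
  have hbe₁' : ∀ ⦃A B : S.C⦄ (φ ψ : A ⟶ B), 𝔉.pre.BaseEquivalent φ ψ →
      𝔉.pre.BaseEquivalent (Ψ.inverse.map φ) (Ψ.inverse.map ψ) := by
    rw [h𝔉]; exact hbe'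
  have hiso : ∀ ⦃A B : S.C⦄ (c : A ≅ B), 𝔉.pre.div c.hom = 1 := by
    rw [h𝔉]; exact S.div_iso_eq_one_of_hypotheses h
  exact gpMap_psiPhi_mem_principalDivisors_iff 𝔉 ι induced hpre₁ hbe₁ hpre₁' hbe₁' hiso x

end ModelCase

/-! ### §2 At abc-iut-L2-t4's assembled §5 data `ofBiKummerData` (any slim FSM-type base) -/

section OfBiKummerData

variable {K : Type u₀} [Field K]
  {X : SemiGraphs.TemperedArithmeticGroup.{u₀} K} {D₀ : Type u₀} [Category.{v₀} D₀]
  {V : FrdIMonoidStub.{w}} {T₀ : RealifiedDivisorMonoids (D₀ := D₀) V} {D : Type u} [Category.{v} D]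
  {VD : FrdICatStub.{u, v, w} D} {S : BiKummerSetting X T₀ D VD}
  {pullFrac : ∀ {A A' : S.C} (_ : A' ⟶ A), S.biratUnits A → S.biratUnits A'}
  {lv N : ℕ+} {T : ThetaEnvData.{max v w} N} {θr : S.biratUnits S.Aodot} {Bl : S.C}
  {Pl : S.FractionPair θr Bl} {Rl : S.NthRoot θr Pl lv pullFrac}
  (h : ModelFrobenioid.Hypotheses S.tf.divisorMonoid S.tf.ratFnFunctor)
  (toB : ∀ A : S.C, S.biratUnits A →* S.tf.biratUnitsModel A)
  (Q : FrobenioidTheta.ThetaSubquotientStub.{w} D) (odd_l : Odd (lv : ℕ)) (R : S.NthRoot Rl.root Rl.pair N pullFrac)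
  (ιX : T.PiX ≃ₜ* X.Pi) (hopen : IsOpen ((S.galoisSurj R.AN.base R.αData.isGalois).ker : Set X.Pi))
  (σ : Aut R.AN.base →* Aut R.AN) (K' : Type w) [Field K'] (constEmb : K'ˣ →* S.tf.biratUnitsModel R.BN)
  (constEmb_injective : Function.Injective constEmb)
  (hdivc : ∀ g : Aut R.BN.base,
    ModelFrobenioid.div ((σ ((BiKummerSetting.NthRoot.baseIso S R).conjAut.symm g)).hom ≫ R.pair.num) =
      ModelFrobenioid.div R.pair.num)
  (hdivp : ∀ y : T.PiYdd,
    ModelFrobenioid.div ((σ (S.galoisSurj R.AN.base R.αData.isGalois (ιX y.1))).hom ≫ R.pair.den) =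
      ModelFrobenioid.div R.pair.den)

/-- **F1 = `Div_B(B(A^bs))` at `𝔉 := ofBiKummerData …`, hypothesis-free**: for every object `A`, `x ∈ Φ(A^bs)^gp` lies in
`principalDivisors 𝔉.pre A` iff `x = Div_B(b)` for some `b ∈ B(A^bs)` — print's «image of the birational function monoid»
([FrdI] Thm. 5.2 (ii)).  [cite: MochizukiEtTh2009, Prop 5.3 proof p.326 (PDF p.100)] [cite: MochizukiFrdI2008, Thm. 5.2 (ii) p.101] -/
theorem mem_principalDivisors_ofBiKummerData_iff (A : S.C)
    (x : Algebra.GrothendieckGroup (S.tf.divisorMonoid.obj (op A.base))) :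
    x ∈ principalDivisors (ofBiKummerData h toB Q odd_l R ιX hopen σ K' constEmb constEmb_injective hdivc hdivp).pre A ↔
      ∃ b : S.tf.ratFnFunctor.obj (op A.base), divB S.tf.divisorMonoid S.tf.ratFnFunctor S.tf.divBNatTrans (op A.base) b = x :=
  S.mem_principalDivisors_iff_of_model A x

include h in
/-- **F1-Aut at `𝔉 := ofBiKummerData …`** — for every object `A` and `g ∈ Aut_C(A)`, `g·x` is principal iff `x` is; the only
input, «isomorphisms are isometries», is DISCHARGED by the model hypotheses ([FrdI] Thm. 5.2, Rem. 1.1.1).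
[cite: MochizukiEtTh2009, Prop 5.3 (vi) p.326 (PDF p.100)] [cite: MochizukiFrdI2008, Rem. 1.1.1 p.21] -/
theorem gpMap_pullAut_mem_principalDivisors_iff_ofBiKummerData {A : S.C} (g : Aut A)
    (x : Algebra.GrothendieckGroup (S.tf.divisorMonoid.obj (op A.base))) :
    ThetaFrobenioid.gpMap ((ofBiKummerData h toB Q odd_l R ιX hopen σ K' constEmb constEmb_injective hdivc hdivp).pullAut
        g).toMonoidHom x ∈
        principalDivisors (ofBiKummerData h toB Q odd_l R ιX hopen σ K' constEmb constEmb_injective hdivc hdivp).pre A ↔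
      x ∈ principalDivisors (ofBiKummerData h toB Q odd_l R ιX hopen σ K' constEmb constEmb_injective hdivc hdivp).pre A :=
  gpMap_pullAut_mem_principalDivisors_iff_of_pre_eq h _
    (ofBiKummerData_pre h toB Q odd_l R ιX hopen σ K' constEmb constEmb_injective hdivc hdivp) g x

include h in
/-- **F1-Ψ at `𝔉 := ofBiKummerData …`** — for every self-equivalence `Ψ`, chosen `ι : Ψ(A_⊚) ⥲ A_⊚` and `Ψ`-INDUCED `e`
([FrdI] Thm. 4.9's divisor clause, `induced`): `(Ψ^Φ_{A_⊚})^gp x` is principal iff `x` is — the [FrdI] Thm. 3.4 (ii)(v)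
binders and `hiso` DISCHARGED over a slim base of FSM-type (`Φ` non-dilating, a non-group-like object).
[cite: MochizukiEtTh2009, Prop 5.3 proof p.326 (PDF p.100)] [cite: MochizukiFrdI2008, Thm. 3.4 (v) p.63] [cite: MochizukiFrdI2008, Thm. 4.9 p.88] -/
theorem gpMap_psiPhi_mem_principalDivisors_iff_ofBiKummerData (hD : IsOfFSMType D) (hslim : IsSlim D)
    (hnd : IsNonDilatingOn S.tf.divisorMonoid)
    (hN : ∃ A : S.C, ¬ (PreFrobenioidData.ofModel S.tf.divisorMonoid S.tf.ratFnFunctor S.tf.divBNatTrans).IsGroupLikeObj A)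
    (Ψ : S.C ≌ S.C)
    (ι : Ψ.functor.obj (ofBiKummerData h toB Q odd_l R ιX hopen σ K' constEmb constEmb_injective hdivc hdivp).Acirc ≅
      (ofBiKummerData h toB Q odd_l R ιX hopen σ K' constEmb constEmb_injective hdivc hdivp).Acirc)
    {e : (ofBiKummerData h toB Q odd_l R ιX hopen σ K' constEmb constEmb_injective hdivc hdivp).PhiAcirc ≃*
      (ofBiKummerData h toB Q odd_l R ιX hopen σ K' constEmb constEmb_injective hdivc hdivp).pre.Mon
        ((ofBiKummerData h toB Q odd_l R ιX hopen σ K' constEmb constEmb_injective hdivc hdivp).base.obj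
          (Ψ.functor.obj (ofBiKummerData h toB Q odd_l R ιX hopen σ K' constEmb constEmb_injective hdivc hdivp).Acirc))}
    (induced : (DivisorTransportStub.ofThm49
      (ofBiKummerData h toB Q odd_l R ιX hopen σ K' constEmb constEmb_injective hdivc hdivp)).IsInducedBy Ψ
        (ofBiKummerData h toB Q odd_l R ιX hopen σ K' constEmb constEmb_injective hdivc hdivp).Acirc e)
    (x : Algebra.GrothendieckGroup
      (ofBiKummerData h toB Q odd_l R ιX hopen σ K' constEmb constEmb_injective hdivc hdivp).PhiAcirc) :
    ThetaFrobenioid.gpMap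
        (psiPhi (ofBiKummerData h toB Q odd_l R ιX hopen σ K' constEmb constEmb_injective hdivc hdivp) Ψ ι e).toMonoidHom x ∈
        principalDivisors (ofBiKummerData h toB Q odd_l R ιX hopen σ K' constEmb constEmb_injective hdivc hdivp).pre
          (ofBiKummerData h toB Q odd_l R ιX hopen σ K' constEmb constEmb_injective hdivc hdivp).Acirc ↔
      x ∈ principalDivisors (ofBiKummerData h toB Q odd_l R ιX hopen σ K' constEmb constEmb_injective hdivc hdivp).pre
          (ofBiKummerData h toB Q odd_l R ιX hopen σ K' constEmb constEmb_injective hdivc hdivp).Acirc :=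
  gpMap_psiPhi_mem_principalDivisors_iff_of_pre_eq h _
    (ofBiKummerData_pre h toB Q odd_l R ιX hopen σ K' constEmb constEmb_injective hdivc hdivp) hD hslim hnd hN Ψ ι induced x

end OfBiKummerData

/-! ### §3 At the genuine §5 data `ofConnectedTemperoidData` over `B^temp(Π^tp_X)⁰` (base clauses = tree theorems) -/

section ConnectedTemperoidData

variable {K : Type u₀} [Field K] {X : SemiGraphs.TemperedArithmeticGroup.{u₀} K} {D₀ : Type u₀} [Category.{v₀} D₀]
  {V : FrdIMonoidStub.{w}} {T₀ : RealifiedDivisorMonoids (D₀ := D₀) V}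
  {VD : FrdICatStub.{u₀ + 1, u₀, w} (ConnectedPart (BTemp X.Pi))}
  {tf : TemperedFrobenioid T₀ (ConnectedPart (BTemp X.Pi)) VD} {hZ : tf.monoidType = MonoidType.Z}
  {hP : ∀ A : (ConnectedPart (BTemp X.Pi))ᵒᵖ, IsPerfect (tf.Φ.carrier A)}
  {NH : Subgroup (Field.absoluteGaloisGroup K) → tf.category → ℕ+ → Prop} {A₀ : tf.category}
  {hA₀ : PreFrobenioid.IsFrobeniusTrivial tf.toElem A₀} {hA₀' : SemiGraphs.IsGaloisObj A₀.base.obj}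
  {pullFrac : ∀ {A A' : (BiKummerSetting.mkOfConnectedTemperoid X tf hZ hP NH A₀ hA₀ hA₀').C} (_ : A' ⟶ A),
    (BiKummerSetting.mkOfConnectedTemperoid X tf hZ hP NH A₀ hA₀ hA₀').biratUnits A →
      (BiKummerSetting.mkOfConnectedTemperoid X tf hZ hP NH A₀ hA₀ hA₀').biratUnits A'}
  {lv N : ℕ+} {T : ThetaEnvData.{max u₀ w} N}
  {θ : (BiKummerSetting.mkOfConnectedTemperoid X tf hZ hP NH A₀ hA₀ hA₀').biratUnits
    (BiKummerSetting.mkOfConnectedTemperoid X tf hZ hP NH A₀ hA₀ hA₀').Aodot}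
  {Bl : (BiKummerSetting.mkOfConnectedTemperoid X tf hZ hP NH A₀ hA₀ hA₀').C}
  {Pl : (BiKummerSetting.mkOfConnectedTemperoid X tf hZ hP NH A₀ hA₀ hA₀').FractionPair θ Bl}
  {Rl : (BiKummerSetting.mkOfConnectedTemperoid X tf hZ hP NH A₀ hA₀ hA₀').NthRoot θ Pl lv pullFrac}
  (h : ModelFrobenioid.Hypotheses tf.divisorMonoid tf.ratFnFunctor)
  (Q : FrobenioidTheta.ThetaSubquotientStub.{w} (ConnectedPart (BTemp X.Pi))) (odd_l : Odd (lv : ℕ))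
  (R : (BiKummerSetting.mkOfConnectedTemperoid X tf hZ hP NH A₀ hA₀ hA₀').NthRoot Rl.root Rl.pair N pullFrac)
  (ιX : T.PiX ≃ₜ* X.Pi) (K' : Type w) [Field K'] (constEmb : K'ˣ →* tf.biratUnitsModel R.BN)
  (constEmb_injective : Function.Injective constEmb)
  (hinvc : ∀ g : Aut R.AN.base,
    pull tf.divisorMonoid g.hom (ModelFrobenioid.div R.pair.num) = ModelFrobenioid.div R.pair.num)
  (hinvp : ∀ y : T.PiX, y ∈ T.PiYdd →
    pull tf.divisorMonoid ((BiKummerSetting.mkOfConnectedTemperoid X tf hZ hP NH A₀ hA₀ hA₀').galoisSurj R.AN.base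
      R.αData.isGalois (ιX y)).hom (ModelFrobenioid.div R.pair.den) = ModelFrobenioid.div R.pair.den)

/-- The operations of the genuine §5 data are the model's (`ofConnectedTemperoidData` is an `ofBiKummerData`, whose `pre` is
`ofModel …` by `rfl`). [cite: MochizukiFrdI2008, Thm. 5.2 (i) p.100] -/
theorem ofConnectedTemperoidData_pre :
    (ofConnectedTemperoidData h Q odd_l R ιX K' constEmb constEmb_injective hinvc hinvp).pre =
      PreFrobenioidData.ofModel tf.divisorMonoid tf.ratFnFunctor tf.divBNatTrans :=
  rfl

include h in
/-- **F1-Aut at the genuine §5 data `𝔉 := ofConnectedTemperoidData …`** (model hypotheses `h` only).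
[cite: MochizukiEtTh2009, Prop 5.3 (vi) p.326 (PDF p.100)] [cite: MochizukiFrdI2008, Rem. 1.1.1 p.21] -/
theorem gpMap_pullAut_mem_principalDivisors_iff_ofConnectedTemperoidData
    {A : (BiKummerSetting.mkOfConnectedTemperoid X tf hZ hP NH A₀ hA₀ hA₀').C} (g : Aut A)
    (x : Algebra.GrothendieckGroup (tf.divisorMonoid.obj (op A.base))) :
    ThetaFrobenioid.gpMap ((ofConnectedTemperoidData h Q odd_l R ιX K' constEmb constEmb_injective hinvc hinvp).pullAut
        g).toMonoidHom x ∈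
        principalDivisors (ofConnectedTemperoidData h Q odd_l R ιX K' constEmb constEmb_injective hinvc hinvp).pre A ↔
      x ∈ principalDivisors (ofConnectedTemperoidData h Q odd_l R ιX K' constEmb constEmb_injective hinvc hinvp).pre A :=
  gpMap_pullAut_mem_principalDivisors_iff_of_pre_eq (S := BiKummerSetting.mkOfConnectedTemperoid X tf hZ hP NH A₀ hA₀ hA₀')
    h _ (ofConnectedTemperoidData_pre h Q odd_l R ιX K' constEmb constEmb_injective hinvc hinvp) g x

/-- **F1 = `Div_B(B(A^bs))` at the genuine §5 data, hypothesis-free**: `x ∈ Φ(A^bs)^gp` lies in `principalDivisors 𝔉.pre A` iff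
`x = Div_B(b)` for some `b ∈ B(A^bs)` ([FrdI] Thm. 5.2 (ii)).
[cite: MochizukiEtTh2009, Prop 5.3 proof p.326 (PDF p.100)] [cite: MochizukiFrdI2008, Thm. 5.2 (ii) p.101] -/
theorem mem_principalDivisors_ofConnectedTemperoidData_iff
    (A : (BiKummerSetting.mkOfConnectedTemperoid X tf hZ hP NH A₀ hA₀ hA₀').C)
    (x : Algebra.GrothendieckGroup (tf.divisorMonoid.obj (op A.base))) :
    x ∈ principalDivisors (ofConnectedTemperoidData h Q odd_l R ιX K' constEmb constEmb_injective hinvc hinvp).pre A ↔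
      ∃ b : tf.ratFnFunctor.obj (op A.base), divB tf.divisorMonoid tf.ratFnFunctor tf.divBNatTrans (op A.base) b = x :=
  (BiKummerSetting.mkOfConnectedTemperoid X tf hZ hP NH A₀ hA₀ hA₀').mem_principalDivisors_iff_of_model A x

include h in
/-- **F1-Ψ at the genuine §5 data `𝔉 := ofConnectedTemperoidData …`**, for EVERY self-equivalence `Ψ`, chosen
`ι : Ψ(A_⊚) ⥲ A_⊚` and `Ψ`-INDUCED `e` ([FrdI] Thm. 4.9): `(Ψ^Φ_{A_⊚})^gp x` is principal iff `x` is, MODULO {`induced`,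
`Φ` non-dilating, a non-group-like object} — the base clauses «`B^temp(Π^tp_X)⁰` of FSM-type» ([FrdII] Ex. 1.3) and «slim»
([SemiAnbd] Rmk. 3.4.1) being THEOREMS of the tree.
[cite: MochizukiEtTh2009, Prop 5.3 proof p.326 (PDF p.100)] [cite: MochizukiFrdI2008, Thm. 3.4 (v) p.63] [cite: MochizukiFrdI2008, Thm. 4.9 p.88] -/
theorem gpMap_psiPhi_mem_principalDivisors_iff_ofConnectedTemperoidData (hnd : IsNonDilatingOn tf.divisorMonoid)
    (hN : ∃ A : (BiKummerSetting.mkOfConnectedTemperoid X tf hZ hP NH A₀ hA₀ hA₀').C,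
      ¬ (PreFrobenioidData.ofModel tf.divisorMonoid tf.ratFnFunctor tf.divBNatTrans).IsGroupLikeObj A)
    (Ψ : (BiKummerSetting.mkOfConnectedTemperoid X tf hZ hP NH A₀ hA₀ hA₀').C ≌
      (BiKummerSetting.mkOfConnectedTemperoid X tf hZ hP NH A₀ hA₀ hA₀').C)
    (ι : Ψ.functor.obj (ofConnectedTemperoidData h Q odd_l R ιX K' constEmb constEmb_injective hinvc hinvp).Acirc ≅
      (ofConnectedTemperoidData h Q odd_l R ιX K' constEmb constEmb_injective hinvc hinvp).Acirc)
    {e : (ofConnectedTemperoidData h Q odd_l R ιX K' constEmb constEmb_injective hinvc hinvp).PhiAcirc ≃*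
      (ofConnectedTemperoidData h Q odd_l R ιX K' constEmb constEmb_injective hinvc hinvp).pre.Mon
        ((ofConnectedTemperoidData h Q odd_l R ιX K' constEmb constEmb_injective hinvc hinvp).base.obj
          (Ψ.functor.obj (ofConnectedTemperoidData h Q odd_l R ιX K' constEmb constEmb_injective hinvc hinvp).Acirc))}
    (induced : (DivisorTransportStub.ofThm49
      (ofConnectedTemperoidData h Q odd_l R ιX K' constEmb constEmb_injective hinvc hinvp)).IsInducedBy Ψ
        (ofConnectedTemperoidData h Q odd_l R ιX K' constEmb constEmb_injective hinvc hinvp).Acirc e)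
    (x : Algebra.GrothendieckGroup
      (ofConnectedTemperoidData h Q odd_l R ιX K' constEmb constEmb_injective hinvc hinvp).PhiAcirc) :
    ThetaFrobenioid.gpMap
        (psiPhi (ofConnectedTemperoidData h Q odd_l R ιX K' constEmb constEmb_injective hinvc hinvp) Ψ ι e).toMonoidHom x ∈
        principalDivisors (ofConnectedTemperoidData h Q odd_l R ιX K' constEmb constEmb_injective hinvc hinvp).pre
          (ofConnectedTemperoidData h Q odd_l R ιX K' constEmb constEmb_injective hinvc hinvp).Acirc ↔
      x ∈ principalDivisors (ofConnectedTemperoidData h Q odd_l R ιX K' constEmb constEmb_injective hinvc hinvp).pre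
          (ofConnectedTemperoidData h Q odd_l R ιX K' constEmb constEmb_injective hinvc hinvp).Acirc := by
  haveI := X.secondCountableTopology
  exact gpMap_psiPhi_mem_principalDivisors_iff_of_pre_eq (S := BiKummerSetting.mkOfConnectedTemperoid X tf hZ hP NH A₀ hA₀ hA₀')
    h _ (ofConnectedTemperoidData_pre h Q odd_l R ιX K' constEmb constEmb_injective hinvc hinvp)
    QuasiTemperoid.BTempConnected.connectedPart_isOfFSMType (TemperedArithmeticGroup.isSlim_connectedPart X) hnd hN Ψ ι
    induced x

end ConnectedTemperoidData

end ThetaFrobenioid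

end Literature.AnabelianGeometry.EtaleTheta
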